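import Summits.AnomalousDissipation.AnomalousDissipation.Theorems.MarginalStabilityChainStrainedLayerLawStubVorticityUniformBoundsF
import Summits.AnomalousDissipation.AnomalousDissipation.Theorems.MarginalStabilityChainStrainedLayerLawStubVorticityUniformBoundsB
import Summits.AnomalousDissipation.AnomalousDissipation.Theorems.MarginalStabilityChainStrainedLayerLawStubStrainWorkIdentityA
import Mathlib.Analysis.Calculus.ParametricIntegral

/-!
# Stub `stub_vorticityUniformBounds` (crux stmt-AnomalousDissipation-3007, line `strain-work-sum-rule`) — tools Q:
# the Jacobian integrates to zero; `‖∇w‖₂ = ‖ω‖₂`; zero `x`-mean of `v`; `‖v‖₂ ≤ (L/2π)‖ω‖₂`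

Support file (`--supports stmt-AnomalousDissipation-3007`; registered sub-goal `stub_vorticityUniformBounds_jacobian`).
Slice-level kinematics of a `C²` divergence-free `L`-periodic pair with shear tails `SliceTails C k`:
* `stub_vorticityUniformBounds_jacobian`: `∫∫ (uₓv_y − u_yvₓ) = 0` (cut off with `ψ_R`: `∫∫(∂ₓ(uv_y) − ∂_y(uvₓ))ψ_R = ∫∫ uvₓψ_R′ = O(1/R)`;
  `u` need not decay);
* `kato_integral_gradSq_eq_enstrophy`: `∫∫ |∇(u,v)|² = ∫∫ ω²` (cf. the neighbouring `stub_excessEnergyKinematic_enstrophy`);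
* `kato_integral_v_period_eq_zero`: `∫₀ᴸ v(·, y) = 0` (its `y`-derivative is `−∫uₓ = 0` and it tends to `0`);
* `kato_integral_v_sq_le`: `∫∫ v² ≤ (L/2π)² ∫∫ ω²` (Wirtinger in `x`, tools B, and `∫∫vₓ² ≤ ∫∫|∇w|²`).
All `[folklore]`.
-/

-- `Summit.<Summit>.<Problem>` is the tree's mandated summit-side namespace (CONVENTIONS §2); for this
-- single-conjunct summit the two coincide, so the duplicate is deliberate.
set_option linter.dupNamespace false

noncomputable section

open scoped Topology ENNReal
open Filter Set Function MeasureTheory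

namespace Summit.AnomalousDissipation.AnomalousDissipation.Theorems.StrainedLayerLaw.StrainWorkSumRule

open Literature.Analysis.FluidPDE Literature.Analysis.FluidPDE.StretchedLayer
open Summit.AnomalousDissipation.AnomalousDissipation.Theorems.MarginalStabilityChainStretchedVortexRows

/-! ## The Jacobian integrates to zero; `‖∇w‖₂² = ‖ω‖₂²`; `v` has zero `x`-mean; `‖v‖₂ ≤ (L/2π)‖ω‖₂` -/

section Kinematics

variable {L C k : ℝ} {u v : ℝ → ℝ → ℝ}

/-- **The Jacobian `∂ₓu ∂_yv − ∂_yu ∂ₓv` integrates to zero over the period strip** for `C²` slices, `L`-periodic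
in `x` (`L > 0`), with shear tails `SliceTails C k` (`k > 0`): with the cutoff `ψ_R`,
`∫∫ (uₓv_y − u_yvₓ)ψ_R = ∫∫ (∂ₓ(u v_y) − ∂_y(u vₓ))ψ_R = ∫∫ u vₓ ψ_R′ = O(1/R)`, and `R → ∞`. (No decay of `u`
itself is needed: `u` is bounded and `∇v` decays.) [folklore] -/
theorem stub_vorticityUniformBounds_jacobian {L C k : ℝ} {u v : ℝ → ℝ → ℝ} (hL : 0 < L) (hk : 0 < k)
    (hT : SliceTails C k u v)
    (hu : ContDiff ℝ 2 (fun q : ℝ × ℝ => u q.1 q.2)) (hv : ContDiff ℝ 2 (fun q : ℝ × ℝ => v q.1 q.2))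
    (huper : ∀ x y, u (x + L) y = u x y) (hvper : ∀ x y, v (x + L) y = v x y) :
    ∫ q in Ioc 0 L ×ˢ univ, (dX u q.1 q.2 * dY v q.1 q.2 - dY u q.1 q.2 * dX v q.1 q.2) = 0 := by
  have hC : 0 ≤ C := hT.nonneg
  have hu1 : ContDiff ℝ 1 (fun q : ℝ × ℝ => u q.1 q.2) := hu.of_le one_le_two
  have hv1 : ContDiff ℝ 1 (fun q : ℝ × ℝ => v q.1 q.2) := hv.of_le one_le_two
  have cu : Continuous fun q : ℝ × ℝ => u q.1 q.2 := hu.continuous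
  have cux : Continuous fun q : ℝ × ℝ => dX u q.1 q.2 := continuous_dX hu1
  have cuy : Continuous fun q : ℝ × ℝ => dY u q.1 q.2 := continuous_dY hu1
  have cvx : Continuous fun q : ℝ × ℝ => dX v q.1 q.2 := continuous_dX hv1
  have cvy : Continuous fun q : ℝ × ℝ => dY v q.1 q.2 := continuous_dY hv1
  have cvxy : Continuous fun q : ℝ × ℝ => dX (dY v) q.1 q.2 := continuous_dX (contDiff_one_dY hv)
  have cvyx : Continuous fun q : ℝ × ℝ => dY (dX v) q.1 q.2 := continuous_dY (contDiff_one_dX hv)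
  obtain ⟨Cσ, hCσ0, hCσ⟩ := kato_smoothTransition_deriv_bound
  have hS : MeasurableSet (Ioc (0:ℝ) L ×ˢ (univ : Set ℝ)) := measurableSet_Ioc.prod MeasurableSet.univ
  -- pointwise bounds
  have hub : ∀ x y, |u x y| ≤ 1 + C := hT.abs_u_le hk
  have hle1 : ∀ y : ℝ, Real.exp (-k * |y|) ≤ 1 := fun y => Real.exp_le_one_iff.2 (by nlinarith [abs_nonneg y])
  have hjac : ∀ x y, |dX u x y * dY v x y - dY u x y * dX v x y| ≤ 2 * C ^ 2 * Real.exp (-k * |y|) := fun x y => by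
    have h1 := hT.abs_dX_u_le x y; have h2 := hT.abs_dY_v_le x y; have h3 := hT.abs_dY_u_le x y
    have h4 := hT.abs_dX_v_le x y
    have hb : ∀ {a b : ℝ}, |a| ≤ C * Real.exp (-k * |y|) → |b| ≤ C * Real.exp (-k * |y|) →
        |a * b| ≤ C ^ 2 * Real.exp (-k * |y|) := fun {a b} ha hb => by
      rw [abs_mul]
      calc |a| * |b| ≤ C * Real.exp (-k * |y|) * (C * Real.exp (-k * |y|)) := mul_le_mul ha hb (abs_nonneg _) (by positivity)
        _ = C ^ 2 * Real.exp (-k * |y|) * Real.exp (-k * |y|) := by ring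
        _ ≤ C ^ 2 * Real.exp (-k * |y|) * 1 := mul_le_mul_of_nonneg_left (hle1 y) (by positivity)
        _ = C ^ 2 * Real.exp (-k * |y|) := mul_one _
    calc |dX u x y * dY v x y - dY u x y * dX v x y| ≤ |dX u x y * dY v x y| + |dY u x y * dX v x y| := abs_sub _ _
      _ ≤ C ^ 2 * Real.exp (-k * |y|) + C ^ 2 * Real.exp (-k * |y|) := add_le_add (hb h1 h2) (hb h3 h4)
      _ = 2 * C ^ 2 * Real.exp (-k * |y|) := by ring
  have iJ : IntegrableOn (fun q : ℝ × ℝ => dX u q.1 q.2 * dY v q.1 q.2 - dY u q.1 q.2 * dX v q.1 q.2) (Ioc 0 L ×ˢ univ) :=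
    integrableOn_strip_of_abs_le_exp (by fun_prop) (by positivity) hk fun x _ y => hjac x y
  -- the cut-off Jacobian integral equals `∫∫ u vₓ ψ_R′`
  have hcut : ∀ R : ℝ, 0 < R → ∫ q in Ioc 0 L ×ˢ univ, (dX u q.1 q.2 * dY v q.1 q.2 - dY u q.1 q.2 * dX v q.1 q.2) *
      (Real.smoothTransition (2 - q.2 / R) * Real.smoothTransition (2 + q.2 / R)) =
      ∫ q in Ioc 0 L ×ˢ univ, u q.1 q.2 * dX v q.1 q.2 *
        deriv (fun y => Real.smoothTransition (2 - y / R) * Real.smoothTransition (2 + y / R)) q.2 := by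
    intro R hR
    set ψ : ℝ → ℝ := fun y => Real.smoothTransition (2 - y / R) * Real.smoothTransition (2 + y / R) with hψdef
    have hψ : ContDiff ℝ 1 ψ := kato_cutoff_contDiff R
    have cψ : Continuous ψ := hψ.continuous
    have cψ' : Continuous (deriv ψ) := hψ.continuous_deriv le_rfl
    have hψR : ∀ y, 2 * R ≤ |y| → ψ y = 0 := fun y hy => kato_cutoff_eq_zero hR hy
    have hψ'0 : ∀ y, 2 * R + 1 ≤ |y| → deriv ψ y = 0 := fun y hy =>
      kato_cutoff_deriv_eq_zero_of_gt hR (by linarith)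
    have hψd : ∀ y, HasDerivAt ψ (deriv ψ y) y := fun y => (hψ.differentiable one_ne_zero y).hasDerivAt
    have hIψ : ∀ F : ℝ × ℝ → ℝ, Continuous F → IntegrableOn (fun q : ℝ × ℝ => F q * ψ q.2) (Ioc 0 L ×ˢ univ) :=
      fun F hF => kato_integrableOn_strip_of_eq_zero (R := 2 * R) (hF.mul (cψ.comp continuous_snd))
        fun x _ y hy => by simp only [hψR y hy, mul_zero]
    have hIψ' : ∀ F : ℝ × ℝ → ℝ, Continuous F → IntegrableOn (fun q : ℝ × ℝ => F q * deriv ψ q.2) (Ioc 0 L ×ˢ univ) :=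
      fun F hF => kato_integrableOn_strip_of_eq_zero (R := 2 * R + 1) (hF.mul (cψ'.comp continuous_snd))
        fun x _ y hy => by simp only [hψ'0 y hy, mul_zero]
    -- slice derivatives
    have hux : ∀ x y, HasDerivAt (fun s => u s y) (dX u x y) x := hasDerivAt_dX_of_contDiff hu two_ne_zero
    have huy : ∀ x y, HasDerivAt (fun s => u x s) (dY u x y) y := hasDerivAt_dY_of_contDiff hu two_ne_zero
    have hvyx : ∀ x y, HasDerivAt (fun s => dY v s y) (dX (dY v) x y) x :=
      hasDerivAt_dX_of_contDiff (contDiff_one_dY hv) one_ne_zero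
    have hvxy : ∀ x y, HasDerivAt (fun s => dX v x s) (dY (dX v) x y) y :=
      hasDerivAt_dY_of_contDiff (contDiff_one_dX hv) one_ne_zero
    -- `∫∫ ψ ∂ₓ(u v_y) = 0` (integration by parts in `x` against the `x`-independent `ψ`)
    have ibx : ∫ q in Ioc 0 L ×ˢ univ, ψ q.2 * (dX u q.1 q.2 * dY v q.1 q.2 + u q.1 q.2 * dX (dY v) q.1 q.2) = 0 := by
      have h := integral_strip_mul_dX_eq_neg hL.le (f := fun _ y => ψ y) (g := fun x y => u x y * dY v x y)
        (f' := fun _ _ => (0:ℝ)) (g' := fun x y => dX u x y * dY v x y + u x y * dX (dY v) x y)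
        (fun x y => hasDerivAt_const x (ψ y)) (fun x y => (hux x y).mul (hvyx x y))
        (fun y => continuous_const) (fun y => by fun_prop) (fun y => ?_) ?_ ?_
      · rw [h]; simp
      · have h1 := huper 0 y; have h2 := dY_periodic hvper 0 y
        rw [zero_add] at h1 h2
        simp only [h1, h2]
      · have := hIψ (fun q => dX u q.1 q.2 * dY v q.1 q.2 + u q.1 q.2 * dX (dY v) q.1 q.2) (by fun_prop)
        exact this.congr_fun (fun q _ => by simp only; ring) hS
      · simp only [zero_mul]; exact integrableOn_zero
    -- `∫∫ ψ ∂_y(u vₓ) = −∫∫ ψ′ u vₓ`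
    have iby : ∫ q in Ioc 0 L ×ˢ univ, ψ q.2 * (dY u q.1 q.2 * dX v q.1 q.2 + u q.1 q.2 * dY (dX v) q.1 q.2) =
        -∫ q in Ioc 0 L ×ˢ univ, deriv ψ q.2 * (u q.1 q.2 * dX v q.1 q.2) :=
      integral_strip_mul_dY_eq_neg (f := fun _ y => ψ y) (g := fun x y => u x y * dX v x y)
        (f' := fun _ y => deriv ψ y) (g' := fun x y => dY u x y * dX v x y + u x y * dY (dX v) x y)
        (fun x y => hψd y) (fun x y => (huy x y).mul (hvxy x y))
        ((hIψ (fun q => dY u q.1 q.2 * dX v q.1 q.2 + u q.1 q.2 * dY (dX v) q.1 q.2) (by fun_prop)).congr_fun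
          (fun q _ => by simp only; ring) hS)
        ((hIψ' (fun q => u q.1 q.2 * dX v q.1 q.2) (by fun_prop)).congr_fun (fun q _ => by simp only; ring) hS)
        ((hIψ (fun q => u q.1 q.2 * dX v q.1 q.2) (by fun_prop)).congr_fun (fun q _ => by simp only; ring) hS)
    -- combine with Schwarz `dX (dY v) = dY (dX v)`
    have i1 : IntegrableOn (fun q : ℝ × ℝ => ψ q.2 * (dX u q.1 q.2 * dY v q.1 q.2 + u q.1 q.2 * dX (dY v) q.1 q.2))
        (Ioc 0 L ×ˢ univ) :=
      (hIψ (fun q => dX u q.1 q.2 * dY v q.1 q.2 + u q.1 q.2 * dX (dY v) q.1 q.2) (by fun_prop)).congr_fun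
        (fun q _ => by simp only; ring) hS
    have i2 : IntegrableOn (fun q : ℝ × ℝ => ψ q.2 * (dY u q.1 q.2 * dX v q.1 q.2 + u q.1 q.2 * dY (dX v) q.1 q.2))
        (Ioc 0 L ×ˢ univ) :=
      (hIψ (fun q => dY u q.1 q.2 * dX v q.1 q.2 + u q.1 q.2 * dY (dX v) q.1 q.2) (by fun_prop)).congr_fun
        (fun q _ => by simp only; ring) hS
    have e : ∫ q in Ioc 0 L ×ˢ univ, (dX u q.1 q.2 * dY v q.1 q.2 - dY u q.1 q.2 * dX v q.1 q.2) * ψ q.2 =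
        (∫ q in Ioc 0 L ×ˢ univ, ψ q.2 * (dX u q.1 q.2 * dY v q.1 q.2 + u q.1 q.2 * dX (dY v) q.1 q.2)) -
        ∫ q in Ioc 0 L ×ˢ univ, ψ q.2 * (dY u q.1 q.2 * dX v q.1 q.2 + u q.1 q.2 * dY (dX v) q.1 q.2) := by
      rw [← integral_sub i1 i2]
      refine integral_congr_ae (Eventually.of_forall fun q => ?_)
      simp only
      rw [PressureTools.dX_dY_comm hv q.1 q.2]
      ring
    rw [e, ibx, iby, zero_sub, neg_neg]
    exact integral_congr_ae (Eventually.of_forall fun q => by simp only; ring)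
  -- the cut-off integrals tend to the Jacobian integral, and are `O(1/R)`
  have hlim : Tendsto (fun R : ℝ => ∫ q in Ioc 0 L ×ˢ univ, (dX u q.1 q.2 * dY v q.1 q.2 - dY u q.1 q.2 * dX v q.1 q.2) *
      (Real.smoothTransition (2 - q.2 / R) * Real.smoothTransition (2 + q.2 / R))) atTop
      (𝓝 (∫ q in Ioc 0 L ×ˢ univ, (dX u q.1 q.2 * dY v q.1 q.2 - dY u q.1 q.2 * dX v q.1 q.2))) := by
    refine tendsto_integral_filter_of_dominated_convergence
      (fun q => |dX u q.1 q.2 * dY v q.1 q.2 - dY u q.1 q.2 * dX v q.1 q.2|) ?_ ?_ iJ.abs ?_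
    · exact Eventually.of_forall fun R =>
        ((by fun_prop : Continuous fun q : ℝ × ℝ => dX u q.1 q.2 * dY v q.1 q.2 - dY u q.1 q.2 * dX v q.1 q.2).mul
          ((kato_cutoff_contDiff R).continuous.comp continuous_snd)).aestronglyMeasurable
    · refine Eventually.of_forall fun R => Eventually.of_forall fun q => ?_
      rw [Real.norm_eq_abs, abs_mul]
      exact mul_le_of_le_one_right (abs_nonneg _) (kato_cutoff_abs_le_one R q.2)
    · refine Eventually.of_forall fun q => tendsto_const_nhds.congr' ?_
      filter_upwards [eventually_ge_atTop |q.2|, eventually_gt_atTop (0:ℝ)] with R h1 h2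
      rw [kato_cutoff_eq_one h2 h1, mul_one]
  have hsmall : Tendsto (fun R : ℝ => ∫ q in Ioc 0 L ×ˢ univ, (dX u q.1 q.2 * dY v q.1 q.2 - dY u q.1 q.2 * dX v q.1 q.2) *
      (Real.smoothTransition (2 - q.2 / R) * Real.smoothTransition (2 + q.2 / R))) atTop (𝓝 0) := by
    set Ik : ℝ := ∫ q in Ioc 0 L ×ˢ univ, Real.exp (-k * |q.2|) with hIk
    have hb : Tendsto (fun R : ℝ => (1 + C) * C * (2 * Cσ) * Ik * R⁻¹) atTop (𝓝 ((1 + C) * C * (2 * Cσ) * Ik * 0)) :=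
      tendsto_inv_atTop_zero.const_mul _
    rw [mul_zero] at hb
    refine squeeze_zero_norm' ?_ hb
    filter_upwards [eventually_gt_atTop (0:ℝ)] with R hR
    rw [hcut R hR, Real.norm_eq_abs]
    have ik : IntegrableOn (fun q : ℝ × ℝ => Real.exp (-k * |q.2|)) (Ioc 0 L ×ˢ univ) :=
      integrableOn_strip_of_abs_le_exp (C := 1) (by fun_prop) zero_le_one hk fun x _ y => by
        rw [abs_of_nonneg (Real.exp_pos _).le, one_mul]
    have iI : IntegrableOn (fun q : ℝ × ℝ => u q.1 q.2 * dX v q.1 q.2 *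
        deriv (fun y => Real.smoothTransition (2 - y / R) * Real.smoothTransition (2 + y / R)) q.2) (Ioc 0 L ×ˢ univ) :=
      kato_integrableOn_strip_of_eq_zero (R := 2 * R + 1)
        ((cu.mul cvx).mul (((kato_cutoff_contDiff R).continuous_deriv le_rfl).comp continuous_snd))
        fun x _ y hy => by rw [kato_cutoff_deriv_eq_zero_of_gt hR (by linarith), mul_zero]
    refine abs_integral_le_integral_abs.trans ?_
    rw [show (1 + C) * C * (2 * Cσ) * Ik * R⁻¹ = (1 + C) * C * (2 * Cσ / R) * Ik by rw [div_eq_mul_inv]; ring,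
      hIk, ← integral_const_mul]
    refine integral_mono iI.abs (ik.const_mul _) fun q => ?_
    simp only
    rw [abs_mul, abs_mul]
    have h1 := hub q.1 q.2; have h2 := hT.abs_dX_v_le q.1 q.2; have h3 := kato_cutoff_deriv_bound hR hCσ q.2
    calc |u q.1 q.2| * |dX v q.1 q.2| *
        |deriv (fun y => Real.smoothTransition (2 - y / R) * Real.smoothTransition (2 + y / R)) q.2| ≤
        (1 + C) * (C * Real.exp (-k * |q.2|)) * (2 * Cσ / R) :=
          mul_le_mul (mul_le_mul h1 h2 (abs_nonneg _) (by linarith)) h3 (abs_nonneg _) (by positivity)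
      _ = (1 + C) * C * (2 * Cσ / R) * Real.exp (-k * |q.2|) := by ring
  exact tendsto_nhds_unique hlim hsmall

/-- **`‖∇w‖₂² = ‖ω‖₂²` on the period strip** for a `C²` divergence-free slice with shear tails:
`∫∫ (uₓ² + u_y² + vₓ² + v_y²) = ∫∫ ω²` (`|∇w|² − ω² = −2(uₓv_y − u_yvₓ)` when `uₓ + v_y = 0`, and the Jacobian
integrates to zero). [folklore] -/
theorem kato_integral_gradSq_eq_enstrophy (hL : 0 < L) (hk : 0 < k) (hT : SliceTails C k u v)
    (hu : ContDiff ℝ 2 (fun q : ℝ × ℝ => u q.1 q.2)) (hv : ContDiff ℝ 2 (fun q : ℝ × ℝ => v q.1 q.2))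
    (hdiv : ∀ x y, dX u x y + dY v x y = 0)
    (huper : ∀ x y, u (x + L) y = u x y) (hvper : ∀ x y, v (x + L) y = v x y) :
    ∫ q in Ioc 0 L ×ˢ univ, (dX u q.1 q.2 ^ 2 + dY u q.1 q.2 ^ 2 + dX v q.1 q.2 ^ 2 + dY v q.1 q.2 ^ 2) =
      ∫ q in Ioc 0 L ×ˢ univ, vorticity u v q.1 q.2 ^ 2 := by
  have hC : 0 ≤ C := hT.nonneg
  have hu1 : ContDiff ℝ 1 (fun q : ℝ × ℝ => u q.1 q.2) := hu.of_le one_le_two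
  have hv1 : ContDiff ℝ 1 (fun q : ℝ × ℝ => v q.1 q.2) := hv.of_le one_le_two
  have hJ := stub_vorticityUniformBounds_jacobian hL hk hT hu hv huper hvper
  have hle1 : ∀ y : ℝ, Real.exp (-k * |y|) ≤ 1 := fun y => Real.exp_le_one_iff.2 (by nlinarith [abs_nonneg y])
  have hsq : ∀ {a : ℝ} {y : ℝ}, |a| ≤ C * Real.exp (-k * |y|) → a ^ 2 ≤ C ^ 2 * Real.exp (-k * |y|) := fun {a y} ha => by
    have h2 : |a| ≤ C := ha.trans (mul_le_of_le_one_right hC (hle1 y))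
    calc a ^ 2 = |a| * |a| := by rw [← sq, sq_abs]
      _ ≤ C * (C * Real.exp (-k * |y|)) := mul_le_mul h2 ha (abs_nonneg _) hC
      _ = C ^ 2 * Real.exp (-k * |y|) := by ring
  have iG : IntegrableOn (fun q : ℝ × ℝ => dX u q.1 q.2 ^ 2 + dY u q.1 q.2 ^ 2 + dX v q.1 q.2 ^ 2 + dY v q.1 q.2 ^ 2)
      (Ioc 0 L ×ˢ univ) := by
    have cgrad : Continuous fun q : ℝ × ℝ => dX u q.1 q.2 ^ 2 + dY u q.1 q.2 ^ 2 + dX v q.1 q.2 ^ 2 + dY v q.1 q.2 ^ 2 :=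
      (((continuous_dX hu1).pow 2).add ((continuous_dY hu1).pow 2)).add ((continuous_dX hv1).pow 2) |>.add
        ((continuous_dY hv1).pow 2)
    refine integrableOn_strip_of_abs_le_exp cgrad (by positivity : 0 ≤ 4 * C ^ 2) hk fun x _ y => ?_
    rw [abs_of_nonneg (by positivity)]
    have h1 := hsq (hT.abs_dX_u_le x y); have h2 := hsq (hT.abs_dY_u_le x y)
    have h3 := hsq (hT.abs_dX_v_le x y); have h4 := hsq (hT.abs_dY_v_le x y)
    linarith
  have iJ : IntegrableOn (fun q : ℝ × ℝ => dX u q.1 q.2 * dY v q.1 q.2 - dY u q.1 q.2 * dX v q.1 q.2) (Ioc 0 L ×ˢ univ) := by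
    have c : Continuous fun q : ℝ × ℝ => dX u q.1 q.2 * dY v q.1 q.2 - dY u q.1 q.2 * dX v q.1 q.2 :=
      ((continuous_dX hu1).mul (continuous_dY hv1)).sub ((continuous_dY hu1).mul (continuous_dX hv1))
    refine integrableOn_strip_of_abs_le_exp c (by positivity : 0 ≤ 2 * C ^ 2) hk fun x _ y => ?_
    have h1 := hsq (hT.abs_dX_u_le x y); have h2 := hsq (hT.abs_dY_u_le x y)
    have h3 := hsq (hT.abs_dX_v_le x y); have h4 := hsq (hT.abs_dY_v_le x y)
    rw [abs_le]; constructor <;>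
      nlinarith [sq_nonneg (dX u x y - dY v x y), sq_nonneg (dX u x y + dY v x y),
        sq_nonneg (dY u x y - dX v x y), sq_nonneg (dY u x y + dX v x y)]
  have e : ∫ q in Ioc 0 L ×ˢ univ, vorticity u v q.1 q.2 ^ 2 =
      (∫ q in Ioc 0 L ×ˢ univ, (dX u q.1 q.2 ^ 2 + dY u q.1 q.2 ^ 2 + dX v q.1 q.2 ^ 2 + dY v q.1 q.2 ^ 2)) +
        2 * ∫ q in Ioc 0 L ×ˢ univ, (dX u q.1 q.2 * dY v q.1 q.2 - dY u q.1 q.2 * dX v q.1 q.2) := by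
    rw [← integral_const_mul, ← integral_add iG (iJ.const_mul 2)]
    refine integral_congr_ae (Eventually.of_forall fun q => ?_)
    simp only [vorticity]
    have h := hdiv q.1 q.2
    have h' : dY v q.1 q.2 = -dX u q.1 q.2 := by linarith
    rw [h']
    ring
  rw [e, hJ, mul_zero, add_zero]

/-- **`v` has zero mean over every period line**: `∫_{(0,L]} v(·, y) = 0` for a `C²` divergence-free periodic slice
with `v` decaying across the layer (`(∫ v dx)′ = ∫ v_y = −∫ uₓ = 0`, and the mean tends to `0` at `+∞`).
[folklore] -/
theorem kato_integral_v_period_eq_zero (hL : 0 < L) (hk : 0 < k) (hT : SliceTails C k u v)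
    (hu : ContDiff ℝ 2 (fun q : ℝ × ℝ => u q.1 q.2)) (hv : ContDiff ℝ 2 (fun q : ℝ × ℝ => v q.1 q.2))
    (hdiv : ∀ x y, dX u x y + dY v x y = 0) (huper : ∀ x y, u (x + L) y = u x y) (y : ℝ) :
    ∫ x in Ioc 0 L, v x y = 0 := by
  have hC : 0 ≤ C := hT.nonneg
  have hv1 : ContDiff ℝ 1 (fun q : ℝ × ℝ => v q.1 q.2) := hv.of_le one_le_two
  have cv : Continuous fun q : ℝ × ℝ => v q.1 q.2 := hv.continuous
  have cvy : Continuous fun q : ℝ × ℝ => dY v q.1 q.2 := continuous_dY hv1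
  set m : ℝ → ℝ := fun y => ∫ x in (0:ℝ)..L, v x y with hm
  -- `m′ = ∫ v_y = −∫ uₓ = 0`
  have hmd : ∀ y₀, HasDerivAt m 0 y₀ := by
    intro y₀
    have key := intervalIntegral.hasDerivAt_integral_of_dominated_loc_of_deriv_le (μ := volume)
      (F := fun y x => v x y) (F' := fun y x => dY v x y) (a := 0) (b := L) (x₀ := y₀) (bound := fun _ => C)
      (s := univ) univ_mem ?_ ?_ ?_ ?_ ?_ ?_
    · have h := key.2
      have e : ∫ x in (0:ℝ)..L, dY v x y₀ = 0 := by
        have e1 : ∫ x in (0:ℝ)..L, dY v x y₀ = ∫ x in (0:ℝ)..L, -dX u x y₀ :=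
          intervalIntegral.integral_congr fun x _ => by linarith [hdiv x y₀]
        rw [e1, intervalIntegral.integral_neg,
          intervalIntegral.integral_eq_sub_of_hasDerivAt (fun x _ => hasDerivAt_dX_of_contDiff hu two_ne_zero x y₀)
            (((continuous_dX (hu.of_le one_le_two)).comp (continuous_id.prodMk continuous_const)).intervalIntegrable _ _)]
        have := huper 0 y₀; rw [zero_add] at this
        simp [this]
      rw [e] at h
      exact h
    · exact Eventually.of_forall fun y => (cv.comp (continuous_id.prodMk continuous_const)).aestronglyMeasurable
    · exact (cv.comp (continuous_id.prodMk continuous_const)).intervalIntegrable _ _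
    · exact (cvy.comp (continuous_id.prodMk continuous_const)).aestronglyMeasurable
    · refine Eventually.of_forall fun x _ y _ => ?_
      rw [Real.norm_eq_abs]
      exact (hT.abs_dY_v_le x y).trans (mul_le_of_le_one_right hC (Real.exp_le_one_iff.2 (by nlinarith [abs_nonneg y, hk])))
    · exact intervalIntegrable_const
    · exact Eventually.of_forall fun x _ y _ => hasDerivAt_dY_of_contDiff hv two_ne_zero x y
  -- so `m` is constant, and it tends to `0` at `+∞`
  have hconst : ∀ y₁ y₂, m y₁ = m y₂ := fun y₁ y₂ =>
    is_const_of_deriv_eq_zero (fun y => (hmd y).differentiableAt) (fun y => (hmd y).deriv) y₁ y₂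
  have hmb : ∀ y', |m y'| ≤ L * C * Real.exp (-k * |y'|) := fun y' => by
    simp only [hm]
    have h := intervalIntegral.norm_integral_le_of_norm_le_const (a := 0) (b := L) (C := C * Real.exp (-k * |y'|))
      (f := fun x => v x y') fun x _ => by rw [Real.norm_eq_abs]; exact hT.abs_v_le x y'
    rw [Real.norm_eq_abs, sub_zero, abs_of_pos hL] at h
    linarith
  have hlim : Tendsto m atTop (𝓝 0) := tendsto_zero_atTop_of_abs_le_exp hk hmb
  have hmy : m y = 0 := by
    have hc : Tendsto m atTop (𝓝 (m y)) := tendsto_const_nhds.congr fun y' => hconst y y'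
    exact tendsto_nhds_unique hc hlim
  simp only [hm] at hmy
  rwa [intervalIntegral.integral_of_le hL.le] at hmy

/-- **`‖v‖₂² ≤ (L/2π)² ‖ω‖₂²`** on the period strip for a `C²` divergence-free periodic slice with shear tails
(zero `x`-mean of `v` and Wirtinger in `x`, tools B; then `∫∫ vₓ² ≤ ∫∫ |∇w|² = ∫∫ ω²`). [folklore] -/
theorem kato_integral_v_sq_le (hL : 0 < L) (hk : 0 < k) (hT : SliceTails C k u v)
    (hu : ContDiff ℝ 2 (fun q : ℝ × ℝ => u q.1 q.2)) (hv : ContDiff ℝ 2 (fun q : ℝ × ℝ => v q.1 q.2))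
    (hdiv : ∀ x y, dX u x y + dY v x y = 0)
    (huper : ∀ x y, u (x + L) y = u x y) (hvper : ∀ x y, v (x + L) y = v x y) :
    ∫ q in Ioc 0 L ×ˢ univ, v q.1 q.2 ^ 2 ≤ (L / (2 * Real.pi)) ^ 2 * ∫ q in Ioc 0 L ×ˢ univ, vorticity u v q.1 q.2 ^ 2 := by
  have hC : 0 ≤ C := hT.nonneg
  have hu1 : ContDiff ℝ 1 (fun q : ℝ × ℝ => u q.1 q.2) := hu.of_le one_le_two
  have hv1 : ContDiff ℝ 1 (fun q : ℝ × ℝ => v q.1 q.2) := hv.of_le one_le_two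
  have hle1 : ∀ y : ℝ, Real.exp (-k * |y|) ≤ 1 := fun y => Real.exp_le_one_iff.2 (by nlinarith [abs_nonneg y])
  have hsq : ∀ {a : ℝ} {y : ℝ}, |a| ≤ C * Real.exp (-k * |y|) → a ^ 2 ≤ C ^ 2 * Real.exp (-k * |y|) := fun {a y} ha => by
    have h2 : |a| ≤ C := ha.trans (mul_le_of_le_one_right hC (hle1 y))
    calc a ^ 2 = |a| * |a| := by rw [← sq, sq_abs]
      _ ≤ C * (C * Real.exp (-k * |y|)) := mul_le_mul h2 ha (abs_nonneg _) hC
      _ = C ^ 2 * Real.exp (-k * |y|) := by ring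
  have iv2 : IntegrableOn (fun q : ℝ × ℝ => v q.1 q.2 ^ 2) (Ioc 0 L ×ˢ univ) :=
    integrableOn_strip_of_abs_le_exp (C := C ^ 2) (hv.continuous.pow 2) (by positivity) hk fun x _ y => by
      rw [abs_of_nonneg (sq_nonneg _)]; exact hsq (hT.abs_v_le x y)
  have ivx2 : IntegrableOn (fun q : ℝ × ℝ => dX v q.1 q.2 ^ 2) (Ioc 0 L ×ˢ univ) :=
    integrableOn_strip_of_abs_le_exp (C := C ^ 2) ((continuous_dX hv1).pow 2) (by positivity) hk fun x _ y => by
      rw [abs_of_nonneg (sq_nonneg _)]; exact hsq (hT.abs_dX_v_le x y)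
  -- slice by slice Wirtinger, integrated in `y`
  have h1 : ∫ q in Ioc 0 L ×ˢ univ, v q.1 q.2 ^ 2 ≤ (L / (2 * Real.pi)) ^ 2 * ∫ q in Ioc 0 L ×ˢ univ, dX v q.1 q.2 ^ 2 := by
    rw [IntegrableOn, volume_restrict_strip] at iv2 ivx2
    rw [volume_restrict_strip, integral_prod_symm _ iv2, integral_prod_symm _ ivx2, ← integral_const_mul]
    refine integral_mono iv2.integral_prod_right (ivx2.integral_prod_right.const_mul _) fun y => ?_
    exact stub_vorticityUniformBounds_wirtinger_slice_zeroMean hL hv1 hvper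
      (kato_integral_v_period_eq_zero hL hk hT hu hv hdiv huper y)
  -- `∫∫ vₓ² ≤ ∫∫ |∇w|² = ∫∫ ω²`
  have h2 : ∫ q in Ioc 0 L ×ˢ univ, dX v q.1 q.2 ^ 2 ≤ ∫ q in Ioc 0 L ×ˢ univ, vorticity u v q.1 q.2 ^ 2 := by
    rw [← kato_integral_gradSq_eq_enstrophy hL hk hT hu hv hdiv huper hvper]
    refine integral_mono ivx2 ?_ fun q => by simp only; nlinarith [sq_nonneg (dX u q.1 q.2), sq_nonneg (dY u q.1 q.2), sq_nonneg (dY v q.1 q.2)]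
    have cgrad : Continuous fun q : ℝ × ℝ => dX u q.1 q.2 ^ 2 + dY u q.1 q.2 ^ 2 + dX v q.1 q.2 ^ 2 + dY v q.1 q.2 ^ 2 :=
      (((continuous_dX hu1).pow 2).add ((continuous_dY hu1).pow 2)).add ((continuous_dX hv1).pow 2) |>.add
        ((continuous_dY hv1).pow 2)
    refine integrableOn_strip_of_abs_le_exp cgrad (by positivity : 0 ≤ 4 * C ^ 2) hk fun x _ y => ?_
    rw [abs_of_nonneg (by positivity)]
    have h1 := hsq (hT.abs_dX_u_le x y); have h2 := hsq (hT.abs_dY_u_le x y)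
    have h3 := hsq (hT.abs_dX_v_le x y); have h4 := hsq (hT.abs_dY_v_le x y)
    linarith
  exact h1.trans (mul_le_mul_of_nonneg_left h2 (sq_nonneg _))

end Kinematics

end Summit.AnomalousDissipation.AnomalousDissipation.Theorems.StrainedLayerLaw.StrainWorkSumRule

end
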